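import Mathlib
import Literature.MathematicalPhysics.QuantumFieldTheory.Balaban1983to89.B1
import Literature.MathematicalPhysics.QuantumFieldTheory.Balaban1983to89.B1RG242
import Literature.MathematicalPhysics.QuantumFieldTheory.Balaban1983to89.B2Ineq311

/-!
# `Balaban1983to89.B2Ineq311MassTerm` — T. Bałaban, *(Higgs)₂,₃ quantum fields in a finite volume. II. An upper bound*,
Commun. Math. Phys. **86** (1982) 555–594 [Balaban1982Higgs2], (3.11) p. 585: the lower bound
`G′_k ≧ γ₁μ₀²(Lᵏε)²I↾_{Λ₅⁽ᵏ⁾}` obtained, as printed, by *"us[ing] the mass terms in the fundamental operators"* — PROVED for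
the ACTUAL third-term operator of (3.9), the renormalization-group operator `Δ^{(k)} = a_k·1 − a_k²Q_kG_kQ_k^*` of
part I (2.21) with `G_k = (H + a_kQ_k^*Q_k)⁻¹` (part I (2.20)), `H` ↤ the fundamental operator `−Δ^η + μ₀²(Lᵏε)²`:
`Δ^{(k)} ≧ [a_k/(a_k + μ₀²(Lᵏε)²)]·μ₀²(Lᵏε)²·I`, i.e. (3.11) with the EXPLICIT constant `γ₁ = a_k/(a_k + μ₀²(Lᵏε)²)`,
bounded below uniformly in k and ε by `a_∞/(a_∞ + μ₀²)` (a_∞ = a(1 − L⁻²), part I (2.15)); theorems only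

statement-level skeleton of published theorems with citation tags; proofs where landed; nothing here is a claim about the Yang–Mills mass gap

PDF held: `paper:balaban1982-cmp86-higgs23-ii` (journal page = PDF page + 554); p. 585 READ AS AN IMAGE on the ×2 render
`run/shared/lean/pub/pub-balaban/b2b-balaban-ref1/pages/1982-cmp86-higgs23-II/1982-cmp86-higgs23-II-p031-x2.png`.  Unit
`lit-balaban-r14` gen 4 (reader/typer of B1–B2, SECOND READER of B2; B2 fold owner = r02), HOME
`run/shared/lean/pub/lit-balaban/`.  SKELETON row **B2.Eq3.11** ((3.11)–(3.12) p. 585–586; of record: r02's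
`B2Ineq311.ineq311` (the «corollary» step: a lower bound on the third-term form ⇒ (3.11) for `G′_k = Qᵀ·diag(c)·Q + Δ`,
p247616) and `B2Ineq311.ineq311_of_mass_term` (γ₁ = 1 for a third-term operator of the special shape `N + μ₀²ℓ²·1`,
`N ≧ 0`)).

WHY THIS FILE (second-reader note, 2026-08-21).  In (3.9) p. 585 the third and fourth terms of the exponent are
`−½⟨Λ₅⁽ᵏ⁾A_k, Δ^{(k)}_{Λ₅^{(k−1)}}Λ₅⁽ᵏ⁾A_k⟩ − ½⟨Λ₅⁽ᵏ⁾φ_k, Δ^{(k)}_{Λ₅^{(k−1)}}(B^k(Λ₂^{(k−1)′}), Ã^{(k)})Λ₅⁽ᵏ⁾φ_k⟩` (cf. (2.46) p. 567): the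
operator there is the EFFECTIVE operator `Δ^{(k),Lᵏε}` of part I (2.21), *"⟨ψ,Δ^{(k)}ψ⟩ = a_k(Lᵏε)^{−2}⟨ψ,ψ⟩ −
a_k²(Lᵏε)^{−4}⟨ψ,Q_kG^ε_kQ^*_kψ⟩"*, which contains the mass term of the fundamental operator `−Δ^η + μ₀²(Lᵏε)²` only
THROUGH `G_k = (−Δ^η + μ₀²(Lᵏε)² + a_kP_k)⁻¹` — it is not of the form `N + μ₀²ℓ²·1` with `N ≧ 0` (indeed `Δ^{(k)} ≦ a_k·1`
is bounded).  *"To get them it suffices to use the mass terms in the fundamental operators"* (p. 585) therefore means: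
bound `G_k` using only `H ≧ μ₀²ℓ²`; this gives `Q_kG_kQ_k^* ≦ (a_k + μ₀²ℓ²)⁻¹` on the coarse lattice (for the
unit-normalized averaging, `Q_kQ_k^* = 1`) and hence `Δ^{(k)} ≧ a_kμ₀²ℓ²/(a_k + μ₀²ℓ²)·1` — (3.11) with
`γ₁ = a_k/(a_k + μ₀²ℓ²) < 1`, uniformly `≧ a_∞/(a_∞ + μ₀²)` for `ℓ = Lᵏε ≦ 1` since `a_k > a_∞` (part I (2.15),
`B1.ainf_lt_aSeq`).  This file proves exactly that and feeds r02's `B2Ineq311.ineq311` with it; the row's head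
(`proved p247616`, the corollary route) is unaffected.

THE SOURCE TEXT, verbatim, p. 585 [PDF 31]: *"We need the estimates of the quadratic forms in (3.9). Let us denote the
quadratic forms in A_k, φ_k, connected with the first four terms in the exponential under the integral (3.9), by
⟨A_k, G′_kA_k⟩, ⟨φ_k, G″_kφ_k⟩ correspondingly. We will give the estimates from below for these forms. It is sufficient
to get very weak estimates because we have the strong estimates (3.8), (3.10). To get them it suffices to use the mass
terms in the fundamental operators −Δ^η + μ₀²(Lᵏε)² and −Δ^{η,N}_{Ã^{(k)},B^k(Λ₂^{(k−1)′})} + m²(Lᵏε)². In the next section of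
this chapter we will formulate a much stronger estimate, which as a corollary gives  G′_k ≧ γ₁μ₀²(Lᵏε)²I↾_{Λ₅⁽ᵏ⁾},
G″_k ≧ γ₁m²(Lᵏε)²I↾_{Λ₅⁽ᵏ⁾}.  (3.11)"*  Part I [Balaban1982Higgs1] (2.20)–(2.21) p. 610: *"G^ε_k(Ω,A) = (−Δ^{ε,N}_{A,Ω} +
m² + a_k(Lᵏε)^{−2}P_k(A))^{−1}, P_k(A) = Q_k^*(A)Q_k(A), (2.20) … ⟨ψ,Δ^{(k),Lᵏε}(Ω,A)ψ⟩ = a_k(Lᵏε)^{−2}⟨ψ,ψ⟩ −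
a_k²(Lᵏε)^{−4}⟨ψ,Q_k(A)G^ε_k(Ω,A)Q^*_k(A)ψ⟩ (2.21)"*.

DICTIONARY (plain matrix coordinates on the unit lattice, as in `B1RG242.StepData` / `B2Ineq311`): `ι` ↤ the fine
field components (where `H` ↤ −Δ^η + μ₀²(Lᵏε)² acts; symmetric, `H ≧ μ·1`, `μ` ↤ μ₀²(Lᵏε)² or m²(Lᵏε)²), `κ` ↤ the
coarse (k-lattice) components, `Q : Matrix κ ι ℝ` ↤ Q_k with `Q_k^* = Qᵀ` and `QQᵀ = 1` (unit-normalized block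
averaging; the weighted scalar products (I.1.5) are absorbed into the coordinates — the same convention as r02's
`B2Ineq311`, whose statement this file feeds), `α` ↤ a_k (> 0), `G` ↤ G_k = (H + αQᵀQ)⁻¹ (given through `(H + αQᵀQ)·G
= 1`), `rgOp α Q G = α·1 − α²·QGQᵀ` ↤ Δ^{(k)} (I.2.21) = `B1RG242.StepData.Δk` in those coordinates (`rgOp_eq_stepData_Δk`).

WHAT IS PROVED (kernel, no `sorry`, axioms standard).  `dot_mulVec_eq` (adjoint across the dot product),
`normSq_mulVec_le` (‖Q z‖² ≦ ‖z‖² from QQᵀ = 1), `two_dot_sub_le` (2x·w − s‖w‖² ≦ ‖x‖²/s, completing the square),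
**`rgOp_form_lower`** (`(αμ/(α + μ))‖x‖² ≦ xᵀ(α·1 − α²QGQᵀ)x` for symmetric `H ≧ μ·1`, μ > 0, α > 0, QQᵀ = 1 — the
variational identity `yᵀGy = 2y·z − zᵀ(H + αQᵀQ)z`, `z = Gy`, then the mass term and the square), `ratio_mono` and
**`gamma1_uniform`** (`a_∞/(a_∞ + μ₀²) ≦ a_k/(a_k + μ₀²ℓ²)` for 0 < ℓ ≦ 1, k ≧ 1, via `B1.ainf_lt_aSeq`), and the hand-over
**`ineq311_rgOp`** = r02's `B2Ineq311.ineq311` fed with this bound: (3.11) for `G′_k = Q′ᵀ·diag(c)·Q′ + Δ^{(k)}` with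
`γ₁ = α/(α + μ₀²ℓ²)`.  NOT HERE: the Λ₅-restrictions (Dirichlet versions `Δ^{(k)}_{Λ₅^{(k−1)}}`; the same argument applies to
any symmetric `H ≧ μ` on the restricted index set), Prop. 3.1's stronger bound.
-/

namespace Literature.MathematicalPhysics.QuantumFieldTheory.Balaban1983to89.B2Ineq311MassTerm

open Matrix Finset

variable {ι κ : Type*} [Fintype ι] [Fintype κ] [DecidableEq ι] [DecidableEq κ]

/-! ## §1 Elementary matrix algebra -/

omit [DecidableEq ι] [DecidableEq κ] in
/-- Moving a matrix across the Euclidean dot product: `x·(Qv) = (Qᵀx)·v` (Q_k^* = Q_kᵀ in these coordinates).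
KERNEL. [cite: Balaban1982Higgs2, (3.11) p.585] -/
theorem dot_mulVec_eq (Q : Matrix κ ι ℝ) (x : κ → ℝ) (v : ι → ℝ) :
    x ⬝ᵥ (Q *ᵥ v) = (Qᵀ *ᵥ x) ⬝ᵥ v := by
  rw [Matrix.dotProduct_mulVec, ← Matrix.mulVec_transpose]

omit [DecidableEq ι] in
/-- `‖Q z‖² ≦ ‖z‖²` for a unit-normalized averaging `QQᵀ = 1` (QᵀQ is then an orthogonal projection:
`‖z‖² − ‖Qz‖² = ‖z − QᵀQz‖² ≧ 0`). KERNEL. [cite: Balaban1982Higgs2, (3.11) p.585] -/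
theorem normSq_mulVec_le (Q : Matrix κ ι ℝ) (hQ : Q * Qᵀ = 1) (z : ι → ℝ) :
    (Q *ᵥ z) ⬝ᵥ (Q *ᵥ z) ≤ z ⬝ᵥ z := by
  have h1 : z ⬝ᵥ (Qᵀ *ᵥ (Q *ᵥ z)) = (Q *ᵥ z) ⬝ᵥ (Q *ᵥ z) := by
    rw [dot_mulVec_eq Qᵀ, Matrix.transpose_transpose]
  have h2 : (Qᵀ *ᵥ (Q *ᵥ z)) ⬝ᵥ (Qᵀ *ᵥ (Q *ᵥ z)) = (Q *ᵥ z) ⬝ᵥ (Q *ᵥ z) := by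
    rw [dot_mulVec_eq Qᵀ, Matrix.transpose_transpose, Matrix.mulVec_mulVec (Q *ᵥ z) Q Qᵀ, hQ, Matrix.one_mulVec]
  have sq : 0 ≤ (z - Qᵀ *ᵥ (Q *ᵥ z)) ⬝ᵥ (z - Qᵀ *ᵥ (Q *ᵥ z)) := by
    unfold dotProduct
    exact Finset.sum_nonneg fun i _ => mul_self_nonneg _
  rw [sub_dotProduct, dotProduct_sub, dotProduct_sub, h1, h2, dotProduct_comm (Qᵀ *ᵥ (Q *ᵥ z)) z, h1] at sq
  linarith

omit [Fintype ι] [DecidableEq ι] [DecidableEq κ] in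
/-- Completing the square: `2x·w − s‖w‖² ≦ ‖x‖²/s` for s > 0 (`0 ≦ ‖x − sw‖²`). KERNEL. [cite: Balaban1982Higgs2, (3.11) p.585] -/
theorem two_dot_sub_le (x w : κ → ℝ) {s : ℝ} (hs : 0 < s) :
    2 * (x ⬝ᵥ w) - s * (w ⬝ᵥ w) ≤ (x ⬝ᵥ x) / s := by
  have sq : 0 ≤ (x - s • w) ⬝ᵥ (x - s • w) := by
    unfold dotProduct
    exact Finset.sum_nonneg fun i _ => mul_self_nonneg _
  have expand : (x - s • w) ⬝ᵥ (x - s • w) = x ⬝ᵥ x - 2 * s * (x ⬝ᵥ w) + s ^ 2 * (w ⬝ᵥ w) := by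
    simp only [sub_dotProduct, dotProduct_sub, smul_dotProduct, dotProduct_smul, smul_eq_mul, dotProduct_comm w x]
    ring
  rw [le_div_iff₀ hs]
  nlinarith [sq, expand]

/-! ## §2 The RG operator Δ^{(k)} = a_k·1 − a_k²Q_kG_kQ_k^* (I.2.21) and its mass-term lower bound -/

/-- **Δ^{(k)} of part I (2.21)** in plain matrix coordinates: `a_k·1 − a_k²·Q_kG_kQ_kᵀ` (`α` ↤ a_k on the unit
lattice, `G` ↤ G_k = (H + a_kQ_kᵀQ_k)⁻¹ of (I.2.20)) — the operator of the third/fourth term of (3.9) p. 585 and of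
(2.46) p. 567. [cite: Balaban1982Higgs2, (3.9) p.585] -/
def rgOp (α : ℝ) (Q : Matrix κ ι ℝ) (G : Matrix ι ι ℝ) : Matrix κ κ ℝ :=
  α • (1 : Matrix κ κ ℝ) - α ^ 2 • (Q * G * Qᵀ)

/-- `rgOp` IS part I's `B1RG242.StepData.Δk` when the step data are `H`, `Qk = Q`, `Qks = Qᵀ`, `α` (the other fields
are irrelevant to Δk): definitional agreement with the tree's (I.2.21). KERNEL. [cite: Balaban1982Higgs2, (3.9) p.585] -/
theorem rgOp_eq_stepData_Δk {ν : Type*} (H : Matrix ι ι ℝ) (Q : Matrix κ ι ℝ) (Q' : Matrix ν κ ℝ)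
    (Q's : Matrix κ ν ℝ) (α β : ℝ) :
    rgOp α Q (B1RG242.StepData.Gk ⟨H, Q, Qᵀ, Q', Q's, α, β⟩) = B1RG242.StepData.Δk ⟨H, Q, Qᵀ, Q', Q's, α, β⟩ := by
  rfl

/-- **(3.11) from the mass term, for the RG operator** p. 585: if the fundamental operator satisfies `H ≧ μ·1`
(`μ` ↤ μ₀²(Lᵏε)², *"it suffices to use the mass terms in the fundamental operators −Δ^η + μ₀²(Lᵏε)²"*), H symmetric,
`QQᵀ = 1`, `α` = a_k > 0 and `G = (H + αQᵀQ)⁻¹`, then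
`⟨x, Δ^{(k)}x⟩ ≧ (αμ/(α + μ))‖x‖²` — i.e. `Δ^{(k)} ≧ γ₁μ·I` with `γ₁ = a_k/(a_k + μ₀²(Lᵏε)²)`.  Proof: `⟨x,Δx⟩ = α‖x‖² −
α²yᵀGy` with `y = Qᵀx`; `yᵀGy = 2y·z − zᵀ(H + αQᵀQ)z` (`z = Gy`) `≦ 2x·(Qz) − μ‖z‖² − α‖Qz‖² ≦ 2x·w − (μ + α)‖w‖²`
(`w = Qz`, `‖w‖ ≦ ‖z‖`) `≦ ‖x‖²/(μ + α)`. KERNEL. [cite: Balaban1982Higgs2, (3.11) p.585] -/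
theorem rgOp_form_lower (H : Matrix ι ι ℝ) (Q : Matrix κ ι ℝ) (G : Matrix ι ι ℝ) {α μ : ℝ} (hα : 0 < α)
    (hμ : 0 < μ) (hH : ∀ z : ι → ℝ, μ * (z ⬝ᵥ z) ≤ z ⬝ᵥ (H *ᵥ z)) (hQ : Q * Qᵀ = 1)
    (hG : (H + α • (Qᵀ * Q)) * G = 1) (x : κ → ℝ) :
    α * μ / (α + μ) * (x ⬝ᵥ x) ≤ x ⬝ᵥ (rgOp α Q G *ᵥ x) := by
  have hform : x ⬝ᵥ (rgOp α Q G *ᵥ x)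
      = α * (x ⬝ᵥ x) - α ^ 2 * ((Qᵀ *ᵥ x) ⬝ᵥ (G *ᵥ (Qᵀ *ᵥ x))) := by
    rw [rgOp, Matrix.sub_mulVec, dotProduct_sub, Matrix.smul_mulVec, Matrix.one_mulVec, dotProduct_smul,
      Matrix.smul_mulVec, dotProduct_smul, ← Matrix.mulVec_mulVec, ← Matrix.mulVec_mulVec,
      dot_mulVec_eq Q x, smul_eq_mul, smul_eq_mul]
  rw [hform]
  generalize hy : Qᵀ *ᵥ x = y
  have hMz : (H + α • (Qᵀ * Q)) *ᵥ (G *ᵥ y) = y := by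
    rw [Matrix.mulVec_mulVec, hG, Matrix.one_mulVec]
  have h1 : y ⬝ᵥ (G *ᵥ y)
      = 2 * (y ⬝ᵥ (G *ᵥ y)) - (G *ᵥ y) ⬝ᵥ ((H + α • (Qᵀ * Q)) *ᵥ (G *ᵥ y)) := by
    rw [hMz, dotProduct_comm (G *ᵥ y) y]
    ring
  have h2 : μ * ((G *ᵥ y) ⬝ᵥ (G *ᵥ y)) + α * ((Q *ᵥ (G *ᵥ y)) ⬝ᵥ (Q *ᵥ (G *ᵥ y)))
      ≤ (G *ᵥ y) ⬝ᵥ ((H + α • (Qᵀ * Q)) *ᵥ (G *ᵥ y)) := by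
    have hz := hH (G *ᵥ y)
    rw [Matrix.add_mulVec, dotProduct_add, Matrix.smul_mulVec, dotProduct_smul, smul_eq_mul,
      ← Matrix.mulVec_mulVec, dot_mulVec_eq Qᵀ, Matrix.transpose_transpose]
    linarith
  have h3 : y ⬝ᵥ (G *ᵥ y) = x ⬝ᵥ (Q *ᵥ (G *ᵥ y)) := by
    rw [dot_mulVec_eq Q x, hy]
  have h4 : (Q *ᵥ (G *ᵥ y)) ⬝ᵥ (Q *ᵥ (G *ᵥ y)) ≤ (G *ᵥ y) ⬝ᵥ (G *ᵥ y) := normSq_mulVec_le Q hQ _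
  have h5 : 2 * (x ⬝ᵥ (Q *ᵥ (G *ᵥ y))) - (μ + α) * ((Q *ᵥ (G *ᵥ y)) ⬝ᵥ (Q *ᵥ (G *ᵥ y)))
      ≤ (x ⬝ᵥ x) / (μ + α) := two_dot_sub_le x _ (by linarith)
  have hyz : y ⬝ᵥ (G *ᵥ y) ≤ (x ⬝ᵥ x) / (μ + α) := by
    have hμw := mul_le_mul_of_nonneg_left h4 hμ.le
    linarith [h1, h2, h3, h5, hμw]
  have hα2 : α ^ 2 * (y ⬝ᵥ (G *ᵥ y)) ≤ α ^ 2 * ((x ⬝ᵥ x) / (μ + α)) :=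
    mul_le_mul_of_nonneg_left hyz (sq_nonneg α)
  have hs : α + μ ≠ 0 := by linarith
  have hs' : μ + α ≠ 0 := by linarith
  have key : α * μ / (α + μ) * (x ⬝ᵥ x) = α * (x ⬝ᵥ x) - α ^ 2 * ((x ⬝ᵥ x) / (μ + α)) := by
    field_simp
    ring
  linarith [key, hα2]

/-! ## §3 The constant γ₁ = a_k/(a_k + μ₀²(Lᵏε)²) is uniform in k and ε -/

/-- `t ↦ t/(t + s)` is increasing in t and decreasing in s (t, s > 0). KERNEL. [cite: Balaban1982Higgs2, (3.11) p.585] -/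
theorem ratio_mono {t t' s s' : ℝ} (ht : 0 < t) (htt : t ≤ t') (hs' : 0 < s') (hss : s' ≤ s) :
    t / (t + s) ≤ t' / (t' + s') := by
  rw [div_le_div_iff₀ (by linarith) (by linarith)]
  nlinarith [mul_le_mul_of_nonneg_left hss ht.le, mul_le_mul_of_nonneg_right htt hs'.le]

/-- **γ₁ is independent of k and ε**: with a_k = `B1.aSeq a L k` (part I (2.13)/(2.15)) and a_∞ = a(1 − L⁻²) < a_k
(`B1.ainf_lt_aSeq`), for every k ≧ 1 and every scale 0 < ℓ = Lᵏε ≦ 1: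
`a_∞/(a_∞ + μ₀²) ≦ a_k/(a_k + μ₀²ℓ²)` — so (3.11) holds with the k-, ε-independent `γ₁ = a_∞/(a_∞ + μ₀²)`. KERNEL.
[cite: Balaban1982Higgs2, (3.11) p.585] -/
theorem gamma1_uniform {a L μ0sq ℓ : ℝ} {k : ℕ} (ha : 0 < a) (hL : 1 < L) (hk : 1 ≤ k) (hμ : 0 < μ0sq)
    (hℓ0 : 0 < ℓ) (hℓ : ℓ ≤ 1) :
    a * (1 - (L ^ 2)⁻¹) / (a * (1 - (L ^ 2)⁻¹) + μ0sq) ≤ B1.aSeq a L k / (B1.aSeq a L k + μ0sq * ℓ ^ 2) := by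
  have hainf : 0 < a * (1 - (L ^ 2)⁻¹) := by
    have hL2 : 1 < L ^ 2 := by nlinarith
    have : (L ^ 2)⁻¹ < 1 := inv_lt_one_of_one_lt₀ hL2
    exact mul_pos ha (by linarith)
  refine ratio_mono hainf (B1.ainf_lt_aSeq ha hL k hk).le (by positivity) ?_
  have : ℓ ^ 2 ≤ 1 := by nlinarith
  nlinarith

/-! ## §4 Hand-over to r02's (3.11): `B2Ineq311.ineq311` fed with the mass-term bound -/

/-- **(3.11) p. 585 for `G′_k = Q′ᵀ·diag(c)·Q′ + Δ^{(k)}`** (the first four terms of (3.9): next-level averaging squares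
with weights `c ≧ 0` plus the RG operator on Λ₅⁽ᵏ⁾), with the EXPLICIT `γ₁ = a_k/(a_k + μ₀²(Lᵏε)²)`: r02's
`B2Ineq311.ineq311` (the «corollary» step) applied to `rgOp_form_lower` (the «mass terms in the fundamental operators»
step). KERNEL. [cite: Balaban1982Higgs2, (3.11) p.585] -/
theorem ineq311_rgOp {J : Type*} [Fintype J] [DecidableEq J] (Q' : Matrix J κ ℝ) {c : J → ℝ} (hc : ∀ j, 0 ≤ c j)
    (H : Matrix ι ι ℝ) (Q : Matrix κ ι ℝ) (G : Matrix ι ι ℝ) {α μ₀ ℓ : ℝ} (hα : 0 < α) (hμ₀ : 0 < μ₀) (hℓ : 0 < ℓ)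
    (hH : ∀ z : ι → ℝ, μ₀ ^ 2 * ℓ ^ 2 * (z ⬝ᵥ z) ≤ z ⬝ᵥ (H *ᵥ z)) (hQ : Q * Qᵀ = 1)
    (hG : (H + α • (Qᵀ * Q)) * G = 1) (u : κ → ℝ) :
    α / (α + μ₀ ^ 2 * ℓ ^ 2) * μ₀ ^ 2 * ℓ ^ 2 * (u ⬝ᵥ u)
      ≤ u ⬝ᵥ ((Q'ᵀ * (diagonal c * Q') + rgOp α Q G) *ᵥ u) := by
  have hμ : 0 < μ₀ ^ 2 * ℓ ^ 2 := by positivity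
  refine B2Ineq311.ineq311 Q' hc (rgOp α Q G) (γ₁ := α / (α + μ₀ ^ 2 * ℓ ^ 2)) (μ₀ := μ₀) (ℓ := ℓ) ?_ u
  intro v
  have h := rgOp_form_lower H Q G hα hμ hH hQ hG v
  have hs : α + μ₀ ^ 2 * ℓ ^ 2 ≠ 0 := by linarith
  calc α / (α + μ₀ ^ 2 * ℓ ^ 2) * μ₀ ^ 2 * ℓ ^ 2 * (v ⬝ᵥ v)
      = α * (μ₀ ^ 2 * ℓ ^ 2) / (α + μ₀ ^ 2 * ℓ ^ 2) * (v ⬝ᵥ v) := by field_simp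
    _ ≤ v ⬝ᵥ (rgOp α Q G *ᵥ v) := h

end Literature.MathematicalPhysics.QuantumFieldTheory.Balaban1983to89.B2Ineq311MassTerm
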